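import Summits.BirchSwinnertonDyer.BirchSwinnertonDyer.Theses.KatoDescentPotSupersingular
import Summits.BirchSwinnertonDyer.BirchSwinnertonDyer.Theorems.KatoDescentKMCImpReading
import Summits.BirchSwinnertonDyer.Rank1Residual.O6.X3WildOfKMCTorsionFreeMember
import Summits.BirchSwinnertonDyer.Rank1Residual.Additive.N10IsogenyTransport
import Summits.BirchSwinnertonDyer.Rank1Residual.Additive.PotSupersingularClasses
import HarnessLib

/-!
# Route `KatoDescentPotSupersingular` (rung K9, wild `p = 3`, cell `bsd-potss`): the declared RESIDUAL
# `WildRankOne` (item stmt-BirchSwinnertonDyer-19200) FROM KATO'S MAIN CONJECTURE 12.10 AND PERRIN-RIOU'S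
# RATIO AT THE CLOSED TRIPLE `(IsKatoZetaDescentDatumOf, Kato2004.PRRatio, KatoMainConjectureFine)` —
# duty W1′ optional third, K9 twin (bsd-potss-plan g28; seat `bsd-potss-k8t-c4` g16, courtesy;
# `--supports … --as helper`)

WHAT. The siblings `KatoDescentPotSupersingularWildRankOneOfKMC.lean` (kmc, torsion-free member over the
INTERFACE triple + the iff reading) and `…WildRankOneOfHullKMC.lean` (hull currency, interface `ReadsKMC`)
give the residual BY NAME over interface slots. With cell bsd-cm's CLOSED binders
(`Additive/KatoDescentClosedBinders.lean`) and `Theorems/KatoDescentKMCImpReading.lean` §2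
(`rankOne_bsdp_of_kmcFine_of_perrinRiouRatio`: `KatoMainConjectureFine W 3 → PerrinRiouUpToUnitAt
Kato2004.PRRatio W 3 → BSDp W 3` at a `3`-torsion-free additive potentially good analytic-rank-one `W` over the
two image-free readings — NO interface-lemma hypothesis), this file slices to the wild residual: at a wild
pair `(W, 3)` (`ClassO6 W 3`) of analytic rank one, walk to a `3`-torsion-free member `W′ ∼ W` (Mazur–Kenku,
`Addv.exists_torsionFree_member`), get `BSD(W′, 3)` there, transport back (Cassels + GZK + modularity,
`N10.bsdp_of_isIsogenous_of_bsdp`), and read off `MissingPPartAt W 3` (`missingPPartAt_of_bsdp`).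

HONEST LABEL: CONDITIONAL over displayed hypotheses — the two image-free readings at the closed triple, four
published facts (Cassels, GZK, modularity, Mazur–Kenku), and, at every `3`-torsion-free additive potentially
good member of analytic rank one, TWO OPEN conjecture-grade inputs: Kato's Main Conjecture 12.10
(`KatoMainConjectureFine W′ 3`) and Perrin-Riou's conjecture up to a unit for Kato's ratio
(`PerrinRiouUpToUnitAt Kato2004.PRRatio W′ 3`; the `3`-adic Gross–Zagier step at an additive potentially
supersingular prime is absent in print). Item 19200 is declared `residual` / open-problem and is NOT closed
by this file; nothing about Kato's Main Conjecture, Perrin-Riou's conjecture or BSD is asserted; BSD is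
proved for no curve.
[cite: Kato2004Asterisque, Conj. 12.10 (p. 224), §14.14 (p. 243)]
[cite: BurnsKuriharaSano2019, Conj. 1.5 (p. 5), Conj. 2.8 (ii) (p. 10), Thm. 7.6 and Remark 7.7 (p. 29)]
[cite: Cassels1965ArithmeticVIII] [cite: SilvermanAEC2009, IX.6 Example 6.4] [cite: Miller2011LMS, §1 and Def. 1.1]
-/

set_option autoImplicit false
set_option linter.dupNamespace false

noncomputable section

open scoped Classical

namespace Summit.BirchSwinnertonDyer.BirchSwinnertonDyer.Theorems

open WeierstrassCurve Literature.NumberTheory.EllipticCurves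
  Literature.NumberTheory.EllipticCurves.Rank1Residual
  Literature.NumberTheory.EllipticCurves.Rank1Residual.Typed
  Summit.BirchSwinnertonDyer.Rank1Residual.Additive
  Summit.BirchSwinnertonDyer.Rank1Residual
  Summit.BirchSwinnertonDyer.BirchSwinnertonDyer.Theses.KatoDescentPotSupersingular

/-- **The K9 residual `WildRankOne` (item 19200) from KMC 12.10 + PR^× at the CLOSED TRIPLE** — type = the
route decl verbatim: a wild pair `(W, 3)` has `3 ≠ 2`, `Addv W 3`, `0 ≤ ord_3 j` (`ClassO6`); at a
`3`-torsion-free member `W′ ∼ W` (Mazur–Kenku) `KatoDescentKMCImpReading.rankOne_bsdp_of_kmcFine_of_perrinRiouRatio`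
gives `BSD(W′, 3)`, Cassels / GZK / modularity carry it back to `W`, and `MissingPPartAt W 3` follows
(`Ш(W)` finite by GZK). NO interface-lemma hypothesis. Conditional over displayed hypotheses (two image-free
readings, four published facts, the two OPEN inputs KMC 12.10 / PR^× at the torsion-free rank-one members);
the item is NOT closed; BSD is proved for no curve.
[cite: Kato2004Asterisque, Conj. 12.10 (p. 224), §14.14 (p. 243)]
[cite: BurnsKuriharaSano2019, Conj. 1.5 (p. 5), Thm. 7.6 (p. 29)] [cite: Cassels1965ArithmeticVIII]
[cite: SilvermanAEC2009, IX.6 Example 6.4] [cite: Miller2011LMS, §1 and Def. 1.1] -/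
theorem wildRankOne_of_kmcFine_of_perrinRiouRatio
    (hC : TorsionFree.RankOneCountReading IsKatoZetaDescentDatumOf Kato2004.PRRatio)
    (hreal : TorsionFree.RealizableOfKMC IsKatoZetaDescentDatumOf KatoMainConjectureFine)
    (hCassels : bsdRHS_eq_of_isIsogenous) (hGZK : rank_eq_analyticRank_of_analyticRank_le_one)
    (hmod : hasEntireLFunction_rat) (hMK : mazurKenku_exists_cyclic_isogeny)
    (hKP : ∀ (W : WeierstrassCurve ℚ) [W.IsElliptic] [W.IsGloballyMinimal],
      W.analyticRank = 1 → Addv W 3 → 0 ≤ padicValRat 3 W.j → ¬ 3 ∣ W.torsionOrder →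
        KatoMainConjectureFine W 3 ∧ PerrinRiouUpToUnitAt Kato2004.PRRatio W 3) :
    Summit.BirchSwinnertonDyer.BirchSwinnertonDyer.Theses.KatoDescentPotSupersingular.WildRankOne := by
  intro W _ _ _ hr hO
  haveI : Finite W.sha := (hGZK W (by rw [hr])).2
  refine missingPPartAt_of_bsdp W 3 ?_
  -- a `3`-torsion-free member `W′` of the class (Mazur–Kenku walk), the hypotheses transported to it
  obtain ⟨W', hW', hM', hiso, hadd', hj', ht'⟩ :=
    Addv.exists_torsionFree_member hMK hO.1 hO.2.1 hO.padicValRat_j_nonneg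
  haveI := hW'
  haveI := hM'
  have hr' : W'.analyticRank = 1 := by rw [← analyticRank_eq_of_isIsogenous' hiso, hr]
  obtain ⟨hkmc', hPR'⟩ := hKP W' hr' hadd' hj' ht'
  -- KMC 12.10 ∧ PR^× ⟹ BSD_3 at the torsion-free member over the closed triple, then Cassels back to `W`
  have hbsd' : BSDp W' 3 :=
    KatoDescentKMCImpReading.rankOne_bsdp_of_kmcFine_of_perrinRiouRatio hC hreal hGZK hmod W' 3 hr' hO.1
      hadd' hj' ht' hPR' hkmc'
  exact N10.bsdp_of_isIsogenous_of_bsdp 3 hCassels hGZK hmod hiso (by rw [hr]) hbsd'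

end Summit.BirchSwinnertonDyer.BirchSwinnertonDyer.Theorems

end
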